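import Literature.Combinatorics.Designs.GoethalsSeidelArray

/-!
# The order of a Hadamard matrix is `1`, `2` or a multiple of `4`

[Seberry–Yamada, *Hadamard Matrices* (Wiley 2020)] (`SeberryYamada2020`) Lemma 1.7 (iii): an Hadamard matrix can only
have order `1`, `2` or `4t`.  Proof formalised here (the classical three-rows argument): for three distinct rows
`r₁, r₂, r₃` of `H` with `H Hᵀ = n I`, `Σ_j (r₁ⱼ + r₂ⱼ)(r₁ⱼ + r₃ⱼ) = Σ r₁ⱼ² = n`, while each summand
`(r₁ⱼ + r₂ⱼ)(r₁ⱼ + r₃ⱼ) ∈ {0, 4}`; hence `4 ∣ n` as soon as `n ≥ 3`.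
Stated for the tree's `GoethalsSeidel.IsHadamardMatrix` (entries `±1`, `H Hᵀ = |ι| • 1`) over an arbitrary finite
index type (order `0` is allowed and is a multiple of `4`).  Cell pub-namedobj (venture DiscreteObjects), target H:
`668 = 4·167` admits no factorisation into two Hadamard orders `> 1` (product / doubling routes closed).
No `sorry`, no new axioms.
-/

open Finset BigOperators Matrix

namespace Literature.Combinatorics.Designs.HadamardOrder

open Literature.Combinatorics.Designs.GoethalsSeidel (IsHadamardMatrix)

variable {ι : Type*} [Fintype ι] [DecidableEq ι]

/-- row orthogonality read off `H Hᵀ = n • 1`: `Σ_j H i j · H k j = n [i = k]`. [cite: SeberryYamada2020, Definition 1.14 (H Hᵀ = n I)] -/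
lemma row_inner {H : Matrix ι ι ℤ} (hH : IsHadamardMatrix H) (i k : ι) :
    ∑ j, H i j * H k j = if i = k then (Fintype.card ι : ℤ) else 0 := by
  have h := congrFun (congrFun hH.2 i) k
  rw [mul_apply, Matrix.smul_apply, one_apply, smul_eq_mul, mul_ite, mul_one, mul_zero] at h
  simpa only [transpose_apply] using h

/-- for `±1` values, `(u + v)(u + w) ∈ {0, 4}`, in particular `4 ∣ (u + v)(u + w)`. [cite: SeberryYamada2020, Lemma 1.7 (iii) (proof)] -/
lemma four_dvd_pm_term {u v w : ℤ} (hu : u = 1 ∨ u = -1) (hv : v = 1 ∨ v = -1) (hw : w = 1 ∨ w = -1) :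
    (4 : ℤ) ∣ (u + v) * (u + w) := by
  rcases hu with rfl | rfl <;> rcases hv with rfl | rfl <;> rcases hw with rfl | rfl <;> norm_num

/-- **Lemma 1.7 (iii).** The order of a Hadamard matrix is `1`, `2`, or divisible by `4`.
[cite: SeberryYamada2020, Lemma 1.7 (iii)] -/
theorem card_eq_one_or_two_or_four_dvd {H : Matrix ι ι ℤ} (hH : IsHadamardMatrix H) :
    Fintype.card ι = 1 ∨ Fintype.card ι = 2 ∨ 4 ∣ Fintype.card ι := by
  by_cases hle : Fintype.card ι ≤ 2
  · rcases Nat.lt_or_ge (Fintype.card ι) 1 with h0 | h1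
    · right; right
      have : Fintype.card ι = 0 := by omega
      rw [this]
      exact dvd_zero 4
    · rcases Nat.lt_or_ge (Fintype.card ι) 2 with h2 | h2
      · left; omega
      · right; left; omega
  · right; right
    obtain ⟨a, b, c, hab, hac, hbc⟩ := (Fintype.two_lt_card_iff (α := ι)).mp (by omega)
    -- the three-rows identity
    have s1 := row_inner hH a a
    have s2 := row_inner hH a c
    have s3 := row_inner hH b a
    have s4 := row_inner hH b c
    rw [if_pos rfl] at s1
    rw [if_neg hac] at s2
    rw [if_neg (Ne.symm hab)] at s3
    rw [if_neg hbc] at s4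
    have key : ∑ j, (H a j + H b j) * (H a j + H c j) = (Fintype.card ι : ℤ) := by
      calc ∑ j, (H a j + H b j) * (H a j + H c j)
          = ∑ j, (H a j * H a j + H a j * H c j + H b j * H a j + H b j * H c j) :=
            Finset.sum_congr rfl fun j _ => by ring
        _ = ∑ j, H a j * H a j + ∑ j, H a j * H c j + ∑ j, H b j * H a j + ∑ j, H b j * H c j := by
            simp only [Finset.sum_add_distrib]
        _ = (Fintype.card ι : ℤ) := by rw [s1, s2, s3, s4]; ring
    have hdvd : (4 : ℤ) ∣ ∑ j, (H a j + H b j) * (H a j + H c j) :=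
      Finset.dvd_sum fun j _ => four_dvd_pm_term (hH.1 a j) (hH.1 b j) (hH.1 c j)
    rw [key] at hdvd
    exact_mod_cast hdvd

/-- hence an order `> 2` is divisible by `4`. [cite: SeberryYamada2020, Lemma 1.7 (iii)] -/
theorem four_dvd_card_of_two_lt {H : Matrix ι ι ℤ} (hH : IsHadamardMatrix H) (h2 : 2 < Fintype.card ι) :
    4 ∣ Fintype.card ι := by
  rcases card_eq_one_or_two_or_four_dvd hH with h | h | h
  · omega
  · omega
  · exact h

end Literature.Combinatorics.Designs.HadamardOrder
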